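import Summits.Ventures.PercRepro.C041TriangleLeafMarkStar3A
import Summits.Ventures.PercRepro.C041TriangleLeafMarkStar3B
import Summits.Ventures.PercRepro.C041TriangleLeafMarkStar3C
import Summits.Ventures.PercRepro.C041TriangleLeafMarkStar3D
import Summits.Ventures.PercRepro.C041TriangleLeafMarkStar3E
import Summits.Ventures.PercRepro.C041TriangleLeafMarkStar3F
import Summits.Ventures.PercRepro.C041TriangleLeafMarkStar3G
import Summits.Ventures.PercRepro.C041TriangleLeafMarkStar3H
import Summits.Ventures.PercRepro.C041TriangleLeafMarkStar3I
import Summits.Ventures.PercRepro.C041TriangleLeafMarkStar3J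

/-!
# THEOREM (LEAF + MARK × THREE-LEAF STAR) — coordinate 3 of the identity `θ_△(v d * v 1, v a * v b * v c) = leafMarkStar3A a b c d + leafMarkStar3B a b c d + leafMarkStar3C a b c d + leafMarkStar3D a b c d + leafMarkStar3E a b c d + leafMarkStar3F a b c d + leafMarkStar3G a b c d + leafMarkStar3H a b c d + leafMarkStar3I a b c d + leafMarkStar3J a b c d` (mine-3, gen 67; C-041.md §21 (bg)): the
explicit certificate's coordinate 3 agrees with the triangle map's, by `ring` over the parts' definitions (one
coordinate per module: the six expansions of 1650 terms each exceed one farm node together).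
-/

namespace PercRepro

namespace RelaxedTriangle

open TreeClosure

set_option maxHeartbeats 800000 in
/-- Coordinate 3 of the identity. -/
theorem thetaTri_leafMarkStar3_coord3 (a b c d : ℝ) :
    thetaTri (v d * v 1) (v a * v b * v c) 3 = (leafMarkStar3A a b c d + leafMarkStar3B a b c d + leafMarkStar3C a b c d + leafMarkStar3D a b c d + leafMarkStar3E a b c d + leafMarkStar3F a b c d + leafMarkStar3G a b c d + leafMarkStar3H a b c d + leafMarkStar3I a b c d + leafMarkStar3J a b c d) 3 := by
  simp only [leafMarkStar3A, leafMarkStar3B, leafMarkStar3C, leafMarkStar3D, leafMarkStar3E, leafMarkStar3F, leafMarkStar3G, leafMarkStar3H, leafMarkStar3I, leafMarkStar3J, leafMarkStar3A1, leafMarkStar3A2, leafMarkStar3B1, leafMarkStar3B2, leafMarkStar3B3, leafMarkStar3C1, leafMarkStar3C2, leafMarkStar3D1, leafMarkStar3D2, leafMarkStar3D3, leafMarkStar3D4, leafMarkStar3D5, leafMarkStar3D6, leafMarkStar3D7, leafMarkStar3E1, leafMarkStar3E2, leafMarkStar3E3, leafMarkStar3E4, leafMarkStar3E5, leafMarkStar3E6,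 leafMarkStar3F1, leafMarkStar3F2, leafMarkStar3F3, leafMarkStar3F4, leafMarkStar3G1, leafMarkStar3G2, leafMarkStar3G3, leafMarkStar3G4, leafMarkStar3G5, leafMarkStar3G6, leafMarkStar3G7, leafMarkStar3G8, leafMarkStar3H1, leafMarkStar3H2, leafMarkStar3H3, leafMarkStar3H4, leafMarkStar3H5, leafMarkStar3H6, leafMarkStar3H7, leafMarkStar3I1, leafMarkStar3I2, leafMarkStar3I3, leafMarkStar3I4, leafMarkStar3I5, leafMarkStar3I6, leafMarkStar3J1, leafMarkStar3J2, leafMarkStar3J3, leafMarkStar3J4, thetaTri_eq_vec, Pi.add_apply, Pi.smul_apply, Pi.mul_apply, Pi.one_apply, smul_eq_mul, v]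
  simp
  ring

end RelaxedTriangle

end PercRepro
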